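import Summits.CriticalPhenomena.CardyFormulaZ2.Theses.CardySusyWard
import Literature.Probability.LatticeModels.DartPhase
import Literature.Barriers.CriticalPhenomena.FKParafermionicHalfCauchyRiemann

/-!
# Disproof work file — crux `WeakHolomorphy` (stmt-CriticalPhenomena-11292, route `CardySusyWard`, rank 2)

cdisprove unit `refuter-cdisprove-stmt-CriticalPhenomena-11292-0` (generation 1, 2026-08-16).
Prose lives in docstrings only.  Index of findings: see the section headers §A–§F and the module
docstring of each section; the one-paragraph verdict is at the end of this block.

VERDICT (cycle 1): NO KILL.  `WeakHolomorphy` is the weak (distributional) form of the missing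
"dual half" of discrete Cauchy–Riemann for the `q = 1`, spin-`1/3` parafermionic vertex observable
(DCS 2012 Conj. 8.7 at `q = 1`), stated over genuine objects (Jordan domain `D`, admissible
discretisation families pinned by Hausdorff convergence + `IsZdAdmissible`, the cut-orbit
`medialExploration`, a bounded cylinder-measurable integrand, a finitely supported `finsum`): no junk
handle exists (§F), every hypothesis-dropped variant that becomes false does so only through
percolation asymptotics nobody can prove (§F), and the numerics (exact enumeration `n ≤ 4`, §E; the
sibling crux `CoherentMorera`'s Monte-Carlo; this unit's kit jobs j008143/j008147/j008148/j008149)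
say the crux quantity is ALREADY at the 10⁻³ level of the reference pairing at `L = 16`.  What this
file adds for provers: (§A) the logical shape and the redundancy of `HasCompactSupport`; (§B) the
statement is an UP-SET in the normalisation exponent (`weakHolomorphyParam_mono`) and the 3-hypothesis
family form of `CardyComplexCone` implies it; (§C) a RIGOROUS TRAP: the sublattice-staggered pairing
of the tree's BISECTOR-convention vertex observable telescopes pathwise
(`bisector_stagger_telescope`, with the `N`-independent Abel bound `stagger_sum_bound`), so any
reformulation "crux ⇔ staggered bisector pairing → 0" is vacuous — the crux-equivalent staggered statement must be written with ENTRY phases / corner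
observables (§D: `StaggeredEntryAntiHolomorphy`, and `A2ModeVanishes` in the dart vocabulary of the
sibling route — the `A₂` Fourier mode of the corner classes; `bisector_entry_conversion` is the
per-passage algebra of the convention change); (§D) the typed reduction target;
(§E) exact small-box tables (incl. the second exact local relation `√3K⁽¹⁾+K⁽²⁾ = 0`);
(§F) the load-bearing table; (§G) the dictionary to the only claimed proof in print (Zhou 2024).
-/

noncomputable section

open MeasureTheory Filter Topology Complex
open scoped Real
open Literature.Probability.LatticeModels Literature.Probability.RandomPlanarGeometry
open Literature.Probability.Percolation

namespace Summit.CriticalPhenomena.CardyFormulaZ2.Cruxes.WeakHolomorphy.Disproof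

open Summit.CriticalPhenomena.CardyFormulaZ2.Theses.CardySusyWard (WeakHolomorphy)

/-! ## §A Logical shape of the crux

`WeakHolomorphy = ∀ D Λ, FamilyHyps D Λ → ∀ φ, IsTestFn D φ → Tendsto (dbarPairing Λ (5/3) (1/3) φ) (𝓝[>] 0) (𝓝 0)`
(`weakHolomorphy_iff_param`).  A kill is a single `(D, Λ, φ)` with the six family hypotheses and a
non-vanishing `∂̄`-pairing (`not_weakHolomorphy_iff`).  `HasCompactSupport φ` is implied by
`tsupport φ ⊆ D.carrier` (`hasCompactSupport_of_tsupport_subset`), so a witness only has to produce a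
smooth `φ` supported inside the (bounded) carrier. -/

/-- The six family hypotheses of the crux, bundled: `Λ` is an admissible square-lattice
discretisation family of the Dobrushin domain `D` (vertex set `meshDomain D.carrier δ`, mesh `δ`,
arcs and discrete marked points converging in Hausdorff distance, `IsZdAdmissible` eventually). [folklore] -/
def FamilyHyps (D : DobrushinDomain) (Λ : ℝ → DiscreteDobrushin) : Prop :=
  (∀ δ, (Λ δ).Ω = D.carrier) ∧ (∀ δ, (Λ δ).δ = δ) ∧
  Tendsto (fun δ : ℝ => Metric.hausdorffEDist (Λ δ).arcA (D.arc 0)) (𝓝[>] (0:ℝ)) (𝓝 0) ∧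
  Tendsto (fun δ : ℝ => Metric.hausdorffEDist (Λ δ).arcB (D.arc 1)) (𝓝[>] (0:ℝ)) (𝓝 0) ∧
  Tendsto (fun δ : ℝ => Metric.hausdorffEDist (medialPoint δ '' (Λ δ).zdABEdges) {D.pt 0, D.pt 1})
    (𝓝[>] (0:ℝ)) (𝓝 0) ∧
  (∀ᶠ δ in 𝓝[>] (0:ℝ), (Λ δ).IsZdAdmissible)

/-- The `q = 1`, spin-`σ` parafermionic VERTEX observable of the family `Λ` at mesh `δ`
(bisector winding convention of `MedialWinding.windingAt`, all passages summed):
`F_δ(z) = ∫ passageSum (medialExploration (Λ δ) ω) δ σ z dP_{1/2}`. [folklore] -/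
def obs (Λ : ℝ → DiscreteDobrushin) (σ δ : ℝ) (z : MedialVertex) : ℂ :=
  ∫ ω, MedialPath.passageSum (medialExploration (Λ δ) ω) δ σ z
    ∂(bondPercolation (zdGraph 2) half)

/-- The Wirtinger derivative `∂̄φ = (∂ₓφ + i ∂_yφ)/2` at `p`. [folklore] -/
def dbar (φ : ℂ → ℂ) (p : ℂ) : ℂ := (fderiv ℝ φ p 1 + I * fderiv ℝ φ p I) / 2

/-- The Wirtinger derivative `∂φ = (∂ₓφ - i ∂_yφ)/2` at `p`. [folklore] -/
def del (φ : ℂ → ℂ) (p : ℂ) : ℂ := (fderiv ℝ φ p 1 - I * fderiv ℝ φ p I) / 2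

/-- The normalised `∂̄`-pairing of the crux with a general exponent `s` and spin `σ`:
`δ^s · Σ_z F_δ(z) ∂̄φ(medialPoint δ z)`. The crux is `s = 5/3`, `σ = 1/3`. [folklore] -/
def dbarPairing (Λ : ℝ → DiscreteDobrushin) (s σ : ℝ) (φ : ℂ → ℂ) (δ : ℝ) : ℂ :=
  ((δ ^ s : ℝ) : ℂ) * ∑ᶠ z : MedialVertex, obs Λ σ δ z * dbar φ (medialPoint δ z)

/-- The test functions of the crux: smooth, compactly supported, support inside the domain. [folklore] -/
def IsTestFn (D : DobrushinDomain) (φ : ℂ → ℂ) : Prop :=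
  ContDiff ℝ (⊤ : ℕ∞) φ ∧ HasCompactSupport φ ∧ tsupport φ ⊆ D.carrier

/-- The crux with the normalisation exponent `s` and the spin `σ` as parameters. [folklore] -/
def WeakHolomorphyParam (s σ : ℝ) : Prop :=
  ∀ (D : DobrushinDomain) (Λ : ℝ → DiscreteDobrushin), FamilyHyps D Λ →
    ∀ φ : ℂ → ℂ, IsTestFn D φ → Tendsto (dbarPairing Λ s σ φ) (𝓝[>] (0:ℝ)) (𝓝 0)

/-- The crux is the parametrised statement at `s = 5/3`, `σ = 1/3` (pure unfolding). [folklore] -/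
theorem weakHolomorphy_iff_param : WeakHolomorphy ↔ WeakHolomorphyParam (5 / 3) (1 / 3) := by
  unfold WeakHolomorphy WeakHolomorphyParam FamilyHyps IsTestFn dbarPairing obs dbar
  constructor
  · rintro h D Λ ⟨h1, h2, h3, h4, h5, h6⟩ φ ⟨hφ, hc, hs⟩
    exact h D Λ h1 h2 h3 h4 h5 h6 φ hφ hc hs
  · intro h D Λ h1 h2 h3 h4 h5 h6 φ hφ hc hs
    exact h D Λ ⟨h1, h2, h3, h4, h5, h6⟩ φ ⟨hφ, hc, hs⟩

/-- **What a kill must produce**: one Dobrushin domain, one admissible family and one test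
function with a non-vanishing normalised `∂̄`-pairing. [folklore] -/
theorem not_weakHolomorphy_iff :
    ¬ WeakHolomorphy ↔ ∃ (D : DobrushinDomain) (Λ : ℝ → DiscreteDobrushin), FamilyHyps D Λ ∧
      ∃ φ : ℂ → ℂ, IsTestFn D φ ∧ ¬ Tendsto (dbarPairing Λ (5 / 3) (1 / 3) φ) (𝓝[>] (0:ℝ)) (𝓝 0) := by
  rw [weakHolomorphy_iff_param]
  unfold WeakHolomorphyParam
  push Not
  rfl

/-- `HasCompactSupport φ` is REDUNDANT in the crux: a closed support inside the bounded carrier of a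
Jordan domain is compact (so a refutation witness need not check it, and a prover may drop it).
[folklore] -/
theorem hasCompactSupport_of_tsupport_subset (D : DobrushinDomain) {φ : ℂ → ℂ}
    (h : tsupport φ ⊆ D.carrier) : HasCompactSupport φ :=
  Metric.isCompact_of_isClosed_isBounded (isClosed_tsupport φ) (D.isBounded.subset h)

/-! ## §B Monotonicity in the exponent, the spin parameter, the 3-hypothesis family form

* `weakHolomorphyParam_mono`: for `s ≤ t`, `WeakHolomorphyParam s σ → WeakHolomorphyParam t σ`
  (`δ^t = δ^{t-s}·δ^s` with a bounded first factor on `(0,1)`): the set of exponents for which the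
  spin-`σ` statement holds is an up-set.  Heuristic threshold (NOT a theorem): with `F_δ ≍ δ^{1/3} f`
  the pairing `δ^{s}Σ_z F_δ ∂̄φ` behaves like `δ^{s-5/3}·(2∫ f ∂̄φ + r(δ))`, `r(δ) → 0` the discrete
  `∂̄`-defect; the sibling crux's numerics put `r` at the `10⁻³` level already at `δ = 1/16`, so the
  crux (`s = 5/3`) sits comfortably inside the up-set, `s < 5/3` would need `∫ f∂̄φ = 0` AND a rate.
* spin: `WeakHolomorphy = WeakHolomorphyParam (5/3) (1/3)`; the exact small-box tables of §E show the
  vertex relation (the only exact input anybody has) holds for `σ = 1/3` (and, degenerately, `σ = 1`)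
  and FAILS for `σ ∈ {0, 1/2, 2/3, -1/3}` — the spin is load-bearing for every known mechanism.
* `weakHolomorphy_of_threeHyp`: the 3-hypothesis family form (no Hausdorff convergence of arcs /
  marks; = the first clause of `CardyComplexCone.CoherentMorera`'s conclusion, see
  `Cruxes/CoherentMorera/Disproof.lean`, `WeakHolomorphyFamilies`) implies the crux.  The converse is
  open: hypotheses h3–h5 are "possibly unnecessary" for this interior statement (all three refuter
  one-shot seats concur), they matter only for IDENTIFYING the limit in `ParafermionFamiliesToSLESix`. -/

/-- For `0 < δ` the pairings with exponents `t` and `s` differ by the factor `δ^{t-s}`. [folklore] -/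
theorem dbarPairing_exponent (Λ : ℝ → DiscreteDobrushin) (s t σ : ℝ) (φ : ℂ → ℂ) {δ : ℝ}
    (hδ : 0 < δ) :
    dbarPairing Λ t σ φ δ = ((δ ^ (t - s) : ℝ) : ℂ) * dbarPairing Λ s σ φ δ := by
  unfold dbarPairing
  rw [← mul_assoc, ← Complex.ofReal_mul, ← Real.rpow_add hδ, sub_add_cancel]

/-- **Monotonicity in the normalisation exponent**: the spin-`σ` weak-holomorphy statement with
exponent `s` implies the one with any larger exponent `t ≥ s`. [folklore] -/
theorem weakHolomorphyParam_mono {s t σ : ℝ} (hst : s ≤ t) (h : WeakHolomorphyParam s σ) :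
    WeakHolomorphyParam t σ := by
  intro D Λ hΛ φ hφ
  have h0 := h D Λ hΛ φ hφ
  -- the factor δ^(t-s) tends to a finite limit c along 𝓝[>] 0 (c = 0 if s < t, c = 1 if s = t)
  have hfac : ∃ c : ℂ, Tendsto (fun δ : ℝ => ((δ ^ (t - s) : ℝ) : ℂ)) (𝓝[>] (0:ℝ)) (𝓝 c) := by
    rcases eq_or_lt_of_le hst with heq | hlt
    · refine ⟨1, ?_⟩
      subst heq
      simp only [sub_self, Real.rpow_zero, Complex.ofReal_one]
      exact tendsto_const_nhds
    · refine ⟨((0 : ℝ) : ℂ), ?_⟩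
      have hpos : 0 < t - s := sub_pos.mpr hlt
      have hr : Tendsto (fun δ : ℝ => δ ^ (t - s)) (𝓝[>] (0:ℝ)) (𝓝 0) := by
        have hc : Tendsto (fun δ : ℝ => δ ^ (t - s)) (𝓝 (0:ℝ)) (𝓝 ((0:ℝ) ^ (t - s))) :=
          (Real.continuousAt_rpow_const 0 (t - s) (Or.inr hpos.le)).tendsto
        rw [Real.zero_rpow hpos.ne'] at hc
        exact hc.mono_left nhdsWithin_le_nhds
      exact (Complex.continuous_ofReal.tendsto 0).comp hr
  obtain ⟨c, hc⟩ := hfac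
  have hprod := hc.mul h0
  rw [mul_zero] at hprod
  refine hprod.congr' ?_
  filter_upwards [self_mem_nhdsWithin] with δ hδ
  exact (dbarPairing_exponent Λ s t σ φ hδ).symm

/-- Corollary: the crux follows from the spin-`1/3` statement at any exponent `s ≤ 5/3`. [folklore] -/
theorem weakHolomorphy_of_param_le {s : ℝ} (hs : s ≤ 5 / 3) (h : WeakHolomorphyParam s (1 / 3)) :
    WeakHolomorphy :=
  weakHolomorphy_iff_param.2 (weakHolomorphyParam_mono hs h)

/-- The 3-hypothesis family form of the crux (vertex set, mesh, eventual admissibility only; no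
Hausdorff convergence of arcs or marked points): verbatim the first clause of the conclusion of the
sibling crux `CardyComplexCone.CoherentMorera` (`Cruxes/CoherentMorera/Disproof.lean`,
`WeakHolomorphyFamilies`), in the vocabulary of §A. [folklore] -/
def WeakHolomorphyThreeHyp : Prop :=
  ∀ (D : DobrushinDomain) (Λ : ℝ → DiscreteDobrushin), (∀ δ, (Λ δ).Ω = D.carrier) →
    (∀ δ, (Λ δ).δ = δ) → (∀ᶠ δ in 𝓝[>] (0:ℝ), (Λ δ).IsZdAdmissible) →
    ∀ φ : ℂ → ℂ, IsTestFn D φ → Tendsto (dbarPairing Λ (5 / 3) (1 / 3) φ) (𝓝[>] (0:ℝ)) (𝓝 0)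

/-- The 3-hypothesis family form implies the crux (more families quantified over). The converse —
whether the Hausdorff hypotheses h3–h5 can be dropped — is open ("possibly unnecessary"). [folklore] -/
theorem weakHolomorphy_of_threeHyp (h : WeakHolomorphyThreeHyp) : WeakHolomorphy := by
  rw [weakHolomorphy_iff_param]
  rintro D Λ ⟨h1, h2, -, -, -, h6⟩ φ hφ
  exact h D Λ h1 h2 h6 φ hφ

/-! ## §C A rigorous trap: the staggered pairing of the BISECTOR observable telescopes

Along a medial path the visited medial vertices alternate between the two medial sublattices
(horizontal / vertical lattice edges), the winding on arrival at the `k`-th vertex is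
`W_k = Σ_{j<k} ε_j · (π/2)` with turns `ε_j = ±1`, so `W_k/(π/2) ≡ k (mod 2)` and the sublattice sign
is `s_k = s_0 · (-1)^{W_k/(π/2)}`; the tree's vertex phase (bisector convention,
`MedialWinding.windingAt` = winding on arrival plus half the turn) is
`P^bis_k = exp(-i (1/3) (W_k + ε_k π/4)) = exp(-iπ(2w_k + ε_k)/12)` with `w_k = W_k/(π/2) ∈ ℤ`.
`bisector_stagger_telescope` is the exact identity
`(-1)^{w} · exp(-iπ(2w + ε)/12) = (A(w) - A(w + ε)) / (2cos(π/12))`, `A(w) = exp(i·5πw/6)`, for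
`ε = ±1`; since `w_{k+1} = w_k + ε_k`, the staggered phase `s_k P^bis_k` is an exact DIFFERENCE
`(s_0/(2cos(π/12)))·(A(w_k) - A(w_{k+1}))`, and Abel summation gives, for every path and every
weight `g`, `|Σ_k s_k P^bis_k g(z_k)| ≤ (2cos(π/12))⁻¹ (Σ_k |g(z_{k+1}) - g(z_k)| + 2 sup|g|)`
`= O(δ · |γ| · ‖∇g‖_∞ + ‖g‖_∞)`.  With `|γ| ≤ 4·#(Ω_δ) = O(δ⁻²)`:
`δ^{5/3} Σ_z s_z F^bis_δ(z) g(z_δ) = O(δ^{2/3}) → 0` UNCONDITIONALLY (no percolation input).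
Consequences. (1) The sublattice-staggered `∂`-pairing of the TREE's vertex observable
(`passageSum`/`windingAt`) vanishes trivially; a reformulation "WeakHolomorphy ⇔ staggered bisector
pairing → 0" (tempting after the summation-by-parts identity (‡) of TRIAGE-r1-1 §2) would be
VACUOUS — the crux-equivalent staggered statement is the one with ENTRY phases `exp(-iW_k/3)`
(equivalently: corner/dart observables `bondDartObservable`, the `A₂ = Σ_k (-1)^k E_k` Fourier
mode of the four corner classes of `Theorems/CoherentMorera/Negative/KirchhoffModes.lean`), §D.
(2) It explains the sibling crux's observation "vertex isotropy `|F_h - F_v|/|F_h| ∼ 10⁻³`" for the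
bisector observable while the corner classes differ by 30–50 %: the bisector average kills the
staggered mode identically at leading order.  (3) For provers: converting between vertex conventions
costs `O(δ Σ_e |F(e)|)` only against SMOOTH weights; against staggered weights the bisector and entry
observables differ at leading order (by exactly the `A₂` mode). -/

/-- The phase `A(w) = exp(i·5πw/6)` whose differences telescope the staggered bisector phases. [folklore] -/
def stagA (w : ℤ) : ℂ := cexp (I * (5 * π * w / 6))

/-- `(-1)^w = exp(iπw)` for an integer exponent. [folklore] -/
theorem neg_one_zpow_eq_cexp (w : ℤ) : (-1 : ℂ) ^ w = cexp (w * (π * I)) := by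
  rw [← Complex.exp_pi_mul_I, ← Complex.exp_int_mul]

/-- `2cos x = e^{ix} + e^{-ix}` in `ℂ`. [folklore] -/
theorem ofReal_two_mul_cos (x : ℝ) : ((2 * Real.cos x : ℝ) : ℂ) = cexp (x * I) + cexp (-(x * I)) := by
  push_cast
  rw [Complex.cos]
  rw [neg_mul]
  ring

/-- `cos(π/12) ≠ 0` (indeed `2cos(π/12) = (√6 + √2)/2 ≈ 1.93`). [folklore] -/
theorem cos_pi_div_twelve_ne_zero : Real.cos (π / 12) ≠ 0 :=
  (Real.cos_pos_of_mem_Ioo ⟨by linarith [Real.pi_pos], by linarith [Real.pi_pos]⟩).ne'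

/-- The scalar identity behind the telescoping, `ε = +1`: `e^{-iπ/12}·2cos(π/12) = 1 - e^{i5π/6}`. [folklore] -/
theorem stagger_key_pos :
    cexp (-(I * π / 12)) * ((2 * Real.cos (π / 12) : ℝ) : ℂ) = 1 - cexp (I * (5 * π / 6)) := by
  rw [ofReal_two_mul_cos, mul_add, ← Complex.exp_add, ← Complex.exp_add]
  have h1 : -(I * ↑π / 12) + ↑(π / 12 : ℝ) * I = 0 := by push_cast; ring
  have h2 : -(I * ↑π / 12) + -(↑(π / 12 : ℝ) * I) = -(I * π / 6) := by push_cast; ring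
  have h3 : I * (5 * ↑π / 6) = ↑π * I + -(I * π / 6) := by ring
  rw [h1, h2, h3, Complex.exp_zero, Complex.exp_add, Complex.exp_pi_mul_I]
  ring

/-- The scalar identity behind the telescoping, `ε = -1`: `e^{iπ/12}·2cos(π/12) = 1 - e^{-i5π/6}`. [folklore] -/
theorem stagger_key_neg :
    cexp (I * π / 12) * ((2 * Real.cos (π / 12) : ℝ) : ℂ) = 1 - cexp (-(I * (5 * π / 6))) := by
  rw [ofReal_two_mul_cos, mul_add, ← Complex.exp_add, ← Complex.exp_add]
  have h1 : I * ↑π / 12 + ↑(π / 12 : ℝ) * I = I * π / 6 := by push_cast; ring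
  have h2 : I * ↑π / 12 + -(↑(π / 12 : ℝ) * I) = 0 := by push_cast; ring
  have h3 : -(I * (5 * ↑π / 6)) = -(↑π * I) + I * π / 6 := by ring
  rw [h1, h2, h3, Complex.exp_zero, Complex.exp_add, Complex.exp_neg, Complex.exp_pi_mul_I]
  ring

/-- **Telescoping of the staggered bisector phase** (pathwise algebra, no probability): for an
integer winding count `w` (quarter turns on arrival) and a turn `ε = ±1`,
`(-1)^w · exp(-iπ(2w + ε)/12) = (A(w) - A(w + ε)) / (2cos(π/12))` with `A = stagA`.  Along a medial
path `w_{k+1} = w_k + ε_k` and the sublattice sign is `± (-1)^{w_k}`, so the staggered sum of the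
bisector-convention phases `exp(-i(1/3)(W_k + ε_kπ/4))` against any weight is an Abel sum of
differences of `A` (module docstring of §C). [folklore] -/
theorem bisector_stagger_telescope (w ε : ℤ) (hε : ε = 1 ∨ ε = -1) :
    (-1 : ℂ) ^ w * cexp (-(I * (π * (2 * w + ε) / 12))) =
      (stagA w - stagA (w + ε)) / ((2 * Real.cos (π / 12) : ℝ) : ℂ) := by
  have hc : ((2 * Real.cos (π / 12) : ℝ) : ℂ) ≠ 0 := by
    exact_mod_cast mul_ne_zero two_ne_zero cos_pi_div_twelve_ne_zero
  rw [eq_div_iff hc, neg_one_zpow_eq_cexp, ← Complex.exp_add]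
  have hA : stagA (w + ε) = stagA w * cexp (I * (5 * π * ε / 6)) := by
    unfold stagA; rw [← Complex.exp_add]; congr 1; push_cast; ring
  rcases hε with rfl | rfl
  · have harg : (w : ℂ) * (↑π * I) + -(I * (↑π * (2 * ↑w + ((1 : ℤ) : ℂ)) / 12)) =
        I * (5 * π * w / 6) + -(I * π / 12) := by push_cast; ring
    rw [harg, Complex.exp_add, hA, mul_assoc, stagger_key_pos]
    unfold stagA; push_cast; ring
  · have harg : (w : ℂ) * (↑π * I) + -(I * (↑π * (2 * ↑w + ((-1 : ℤ) : ℂ)) / 12)) =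
        I * (5 * π * w / 6) + I * π / 12 := by push_cast; ring
    rw [harg, Complex.exp_add, hA, mul_assoc, stagger_key_neg]
    unfold stagA; push_cast; ring_nf


/-- `‖A(w)‖ = 1`. [folklore] -/
theorem norm_stagA (w : ℤ) : ‖stagA w‖ = 1 := by
  unfold stagA
  rw [show I * (5 * ↑π * ↑w / 6) = ((5 * π * w / 6 : ℝ) : ℂ) * I by push_cast; ring]
  exact Complex.norm_exp_ofReal_mul_I _

/-- Abel summation of a telescoping sum (pure algebra). [folklore] -/
theorem abel_identity (A g : ℕ → ℂ) (N : ℕ) :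
    ∑ k ∈ Finset.range (N + 1), (A k - A (k + 1)) * g k =
      A 0 * g 0 - A (N + 1) * g N + ∑ k ∈ Finset.range N, A (k + 1) * (g (k + 1) - g k) := by
  induction N with
  | zero => simp; ring
  | succ n ih => rw [Finset.sum_range_succ, ih, Finset.sum_range_succ]; ring

/-- Abel bound: a telescoping sum against weights `g` with unimodular-bounded `A` is controlled by the
total variation of `g` plus two boundary terms — NOT by the number of terms. [folklore] -/
theorem abel_bound (A g : ℕ → ℂ) (hA : ∀ k, ‖A k‖ ≤ 1) (N : ℕ) :
    ‖∑ k ∈ Finset.range (N + 1), (A k - A (k + 1)) * g k‖ ≤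
      ‖g 0‖ + ‖g N‖ + ∑ k ∈ Finset.range N, ‖g (k + 1) - g k‖ := by
  rw [abel_identity]
  have h1 : ‖A 0 * g 0‖ ≤ ‖g 0‖ := by
    rw [norm_mul]; exact mul_le_of_le_one_left (norm_nonneg _) (hA 0)
  have h2 : ‖A (N + 1) * g N‖ ≤ ‖g N‖ := by
    rw [norm_mul]; exact mul_le_of_le_one_left (norm_nonneg _) (hA (N + 1))
  have h3 : ‖∑ k ∈ Finset.range N, A (k + 1) * (g (k + 1) - g k)‖ ≤
      ∑ k ∈ Finset.range N, ‖g (k + 1) - g k‖ := by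
    refine (norm_sum_le _ _).trans (Finset.sum_le_sum fun k _ => ?_)
    rw [norm_mul]; exact mul_le_of_le_one_left (norm_nonneg _) (hA (k + 1))
  calc ‖A 0 * g 0 - A (N + 1) * g N + ∑ k ∈ Finset.range N, A (k + 1) * (g (k + 1) - g k)‖
      ≤ ‖A 0 * g 0 - A (N + 1) * g N‖ + ‖∑ k ∈ Finset.range N, A (k + 1) * (g (k + 1) - g k)‖ :=
        norm_add_le _ _
    _ ≤ (‖A 0 * g 0‖ + ‖A (N + 1) * g N‖) + ∑ k ∈ Finset.range N, ‖g (k + 1) - g k‖ :=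
        add_le_add (norm_sub_le _ _) h3
    _ ≤ ‖g 0‖ + ‖g N‖ + ∑ k ∈ Finset.range N, ‖g (k + 1) - g k‖ := by linarith

/-- The winding count (quarter turns) on arrival at position `k` of a path with turns `ε`. [folklore] -/
def turnSum (ε : ℕ → ℤ) (k : ℕ) : ℤ := ∑ j ∈ Finset.range k, ε j

/-- `turnSum` steps by the turn. [folklore] -/
theorem turnSum_succ (ε : ℕ → ℤ) (k : ℕ) : turnSum ε (k + 1) = turnSum ε k + ε k := by
  unfold turnSum; rw [Finset.sum_range_succ]

/-- **Pathwise bound for the staggered bisector sum.** For ANY sequence of turns `ε_k = ±1` (winding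
counts `w_k = turnSum ε k`) and any weights `g_k`, the staggered sum of bisector phases
`Σ_{k ≤ N} (-1)^{w_k} e^{-iπ(2w_k+ε_k)/12} g_k` is bounded by
`(‖g_0‖ + ‖g_N‖ + Σ_{k<N} ‖g_{k+1} - g_k‖) / (2cos(π/12))`, independently of `N`.  Applied to the
medial exploration (`w_k` = quarter turns on arrival, sublattice sign `s_k = ±(-1)^{w_k}`,
`g_k = ∂φ(z_k)` Lipschitz at scale `δ`): `|Σ_z s_z passageSum-phases · g| ≤ C(‖g‖_∞ + δ‖∇g‖_∞ |γ|)`,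
so `δ^{5/3}·(staggered bisector pairing) = O(δ^{2/3})` deterministically (§C docstring). [folklore] -/
theorem stagger_sum_bound (ε : ℕ → ℤ) (hε : ∀ k, ε k = 1 ∨ ε k = -1) (g : ℕ → ℂ) (N : ℕ) :
    ‖∑ k ∈ Finset.range (N + 1),
        (-1 : ℂ) ^ (turnSum ε k) * cexp (-(I * (π * (2 * turnSum ε k + ε k) / 12))) * g k‖ ≤
      (‖g 0‖ + ‖g N‖ + ∑ k ∈ Finset.range N, ‖g (k + 1) - g k‖) / (2 * Real.cos (π / 12)) := by
  have hc : 0 < 2 * Real.cos (π / 12) :=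
    mul_pos two_pos (Real.cos_pos_of_mem_Ioo ⟨by linarith [Real.pi_pos], by linarith [Real.pi_pos]⟩)
  have hterm : ∀ k, (-1 : ℂ) ^ (turnSum ε k) * cexp (-(I * (π * (2 * turnSum ε k + ε k) / 12))) * g k
      = ((stagA (turnSum ε k) - stagA (turnSum ε (k + 1))) * g k) / ((2 * Real.cos (π / 12) : ℝ) : ℂ) := by
    intro k
    rw [bisector_stagger_telescope _ _ (hε k), turnSum_succ]
    ring
  simp_rw [hterm, ← Finset.sum_div, norm_div]
  have hnorm : ‖((2 * Real.cos (π / 12) : ℝ) : ℂ)‖ = 2 * Real.cos (π / 12) := by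
    rw [Complex.norm_real, Real.norm_eq_abs, abs_of_pos hc]
  rw [hnorm, div_le_div_iff_of_pos_right hc]
  exact abel_bound (fun k => stagA (turnSum ε k)) g (fun k => (norm_stagA _).le) N

/-- **Entry ↔ bisector conversion, per passage** (the algebra of §D step 4): for a turn `ε = ±1`,
`e^{-iεπ/12} = 1/cos(π/12) - 2 sin(π/12)·(1 - e^{-iεπ/6})`, i.e. `P^bis = P^ent/cos(π/12) - 2sin(π/12)·D`
with `D = P^ent - P^out = P^ent(1 - e^{-iεπ/6})` the in-minus-out flux of the passage; uses only
`2 sin(π/12) cos(π/12) = sin(π/6) = 1/2`. [folklore] -/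
theorem bisector_entry_conversion (ε : ℤ) (hε : ε = 1 ∨ ε = -1) :
    cexp (-(I * (π * ε / 12))) * (Real.cos (π / 12) : ℂ) =
      1 - 2 * (Real.sin (π / 12) : ℂ) * (Real.cos (π / 12) : ℂ) * (1 - cexp (-(I * (π * ε / 6)))) := by
  -- 2 sin(π/12) cos(π/12) = sin(π/6) = 1/2, in ℂ
  have hsc : 2 * (Real.sin (π / 12) : ℂ) * (Real.cos (π / 12) : ℂ) = 1 / 2 := by
    rw [Complex.ofReal_sin, Complex.ofReal_cos, ← Complex.sin_two_mul,
      show (2 : ℂ) * ((π / 12 : ℝ) : ℂ) = ((π / 6 : ℝ) : ℂ) by push_cast; ring,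
      ← Complex.ofReal_sin, Real.sin_pi_div_six]
    push_cast
    ring
  rw [hsc]
  -- cos(π/12) = (u + u⁻¹)/2 with u = e^{iπ/12}
  have hcos : (Real.cos (π / 12) : ℂ) = (cexp (↑(π / 12 : ℝ) * I) + cexp (-(↑(π / 12 : ℝ) * I))) / 2 := by
    have := ofReal_two_mul_cos (π / 12)
    push_cast at this ⊢
    linear_combination this / 2
  rw [hcos]
  rcases hε with rfl | rfl
  · have e1 : -(I * (↑π * ((1:ℤ):ℂ) / 12)) + ↑(π / 12 : ℝ) * I = 0 := by push_cast; ring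
    have e2 : -(I * (↑π * ((1:ℤ):ℂ) / 12)) + -(↑(π / 12 : ℝ) * I) = -(I * (↑π * ((1:ℤ):ℂ) / 6)) := by
      push_cast; ring
    rw [mul_div_assoc', mul_add, ← Complex.exp_add, ← Complex.exp_add, e1, e2, Complex.exp_zero]
    ring
  · have e1 : -(I * (↑π * ((-1:ℤ):ℂ) / 12)) + ↑(π / 12 : ℝ) * I = -(I * (↑π * ((-1:ℤ):ℂ) / 6)) := by
      push_cast; ring
    have e2 : -(I * (↑π * ((-1:ℤ):ℂ) / 12)) + -(↑(π / 12 : ℝ) * I) = 0 := by push_cast; ring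
    rw [mul_div_assoc', mul_add, ← Complex.exp_add, ← Complex.exp_add, e1, e2, Complex.exp_zero]
    ring

/-- The medial-sublattice sign used by the typed statements below (`+1` horizontal lattice edge,
`-1` vertical, `0` otherwise); definition repeated in §D's docstring. [folklore] -/
def stagSign (z : MedialVertex) : ℂ :=
  Sym2.lift ⟨fun (x y : Site 2) => (if x 1 = y 1 then (1 : ℂ) else 0) - (if x 0 = y 0 then (1 : ℂ) else 0),
    fun (x y : Site 2) => by
      show ((if x 1 = y 1 then (1 : ℂ) else 0) - (if x 0 = y 0 then (1 : ℂ) else 0)) =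
        ((if y 1 = x 1 then (1 : ℂ) else 0) - (if y 0 = x 0 then (1 : ℂ) else 0))
      rw [if_congr (@eq_comm _ (x 1) (y 1)) rfl rfl, if_congr (@eq_comm _ (x 0) (y 0)) rfl rfl]⟩ z

/-- **The vacuous statement, typed** (so that a seat typing it recognises it): the sublattice-staggered,
`δ^{5/3}`-normalised pairing of the TREE's (bisector) spin-`1/3` vertex observable against the
derivative `∂φ` of a test function tends to `0` — for EVERY family satisfying the six hypotheses.
This is NOT the crux and carries no information about it (§C). [folklore] -/
def StaggeredBisectorPairingVanishes : Prop :=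
  ∀ (D : DobrushinDomain) (Λ : ℝ → DiscreteDobrushin), FamilyHyps D Λ →
    ∀ φ : ℂ → ℂ, IsTestFn D φ → Tendsto (fun δ : ℝ => ((δ ^ ((5 : ℝ) / 3) : ℝ) : ℂ) *
      ∑ᶠ z : MedialVertex, stagSign z * obs Λ (1 / 3) δ z * del φ (medialPoint δ z))
      (𝓝[>] (0:ℝ)) (𝓝 0)

/-- Near-miss (claimed TRUE unconditionally; sorried for bookkeeping only): the staggered bisector
pairing vanishes for every admissible family, by `stagger_sum_bound` applied pathwise to
`medialExploration (Λ δ) ω` (entries alternate sublattice, arrival windings are quarter-turn counts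
`w_k` with `w_k ≡ k`, `windingAt = (w_k + ε_k/2)·π/2`, `|γ| ≤ #darts(Ω_δ) = O(δ⁻²)`, `∂φ` Lipschitz
and bounded), giving `|pairing| ≤ C_φ δ^{5/3}(1 + δ·δ⁻²) = O(δ^{2/3})` deterministically in `ω`, then
dominated convergence is not even needed (the bound is uniform).  Missing Lean: the path bookkeeping
listed, on top of `MedialInterfaceProofs` / `DartPhase`. [folklore] -/
theorem staggeredBisectorPairingVanishes_holds : StaggeredBisectorPairingVanishes := by
  sorry

/-! ## §D The crux-equivalent staggered statement (ENTRY convention) and the typed reduction target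

Notation: `t_z := F^ent_δ(z) = E[Σ_{passages at z} e^{-iW_arrive/3}]` (entry phase; for `z ≠ e_a`
this is `Σ_{darts e into z} bondDartObservable (Λ δ) δ (1/3) e`), `F(e)` the corner/dart observable,
`û_e` the travel direction of the dart `e` (`NW, SW, SE, NE`), `m_e` its midpoint, `s_z = ±1` the
medial-sublattice sign (`stagSign`: `+1` on horizontal lattice edges, `-1` on vertical ones).
DERIVATION of the reduction (all steps exact lattice algebra except the one marked (R1)):
1. (R1) = `VertexRelationExact` (DC2012 Prop. 4 / DCS Prop. 8.6 in the tree's conventions, chirality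
   `χ = +i`: `HalfCRRelationAt I`, equivalently `Σ_{e out of z} û_e F(e) = Σ_{e into z} û_e F(e)` at
   every free-coin medial vertex `z`).  Status: verified EXACTLY by enumeration on the `n = 2, 3, 4`
   boxes of §E (this unit, `|defect| ≤ 4·10⁻¹³`, mirror combination `≈ 1.5`), on four admissible
   rectangles in `ℤ[ζ₂₄]` and on 131 084 single-edge pairs by the `CoherentMorera` disprovers
   (kit j005379/j006260/j005085/j004835), by TRIAGE-r1-1 (3×2, 3×3, 4×3; kit j007778/j007779); its
   one-page proof is Smirnov's coin involution at `z` (the three unit vectors at `45°+120°k` sum to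
   zero); NOT yet a tree theorem — it is the natural first stub of any line here.
2. Summation by parts: `0 = Σ_z φ(z)·[Σ_out ûF - Σ_in ûF] = Σ_e û_e F(e)[φ(tail e) - φ(head e)]`, and
   Taylor at `m_e` (dart length `δ/√2`, direction `û_e`, `∂_û = û∂ + ū∂̄`):
   (‡) `Σ_e F(e)[û_e² ∂φ(m_e) + ∂̄φ(m_e)] = O(δ² Σ_e |F(e)|)`.
3. Grouping darts by their head: `û_e² = +i` for darts into horizontal-edge vertices (headings
   `SW, NE`), `-i` into vertical ones (`NW, SE`), so `Σ_e û_e² F(e)∂φ(m_e) = i Σ_z s_z t_z ∂φ(z) + O(δΣ|F|)`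
   and `Σ_e F(e)∂̄φ(m_e) = Σ_z t_z ∂̄φ(z) + O(δΣ|F|)`.
4. Bisector versus entry at a vertex (pathwise, per passage with turn `ε`):
   `P^bis = P^ent e^{-iεπ/12}`, `D := P_in - P_out = P^ent(1 - e^{-iεπ/6})`, whence EXACTLY
   `T^bis_z = T^ent_z / cos(π/12) - 2 sin(π/12) D_z` (use `4 sin(π/12)cos(π/12) = 1`), and
   `Σ_z g(z) D_z = Σ_e F(e)(g(head e) - g(tail e)) = O(δ Σ|F| ‖∇g‖)` for SMOOTH `g` (telescoping).
5. Hence `δ^{5/3} Σ_z F^bis_δ(z) ∂̄φ(z_δ) = -(i / cos(π/12)) · δ^{5/3} Σ_z s_z F^ent_δ(z) ∂φ(z_δ) + O(δ^{5/3}·δ·Σ_e|F(e)|)`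
   and `Σ_e |F(e)| ≤ E|γ| ≤ #darts(Ω_δ) = O(δ⁻²)`: the error is `O(δ^{2/3}) → 0` with NO percolation
   estimate.  So, given (R1): `WeakHolomorphy ↔ StaggeredEntryAntiHolomorphy`
   (`weakHolomorphy_iff_staggeredEntry_of_vertexRelation`, sorried near-miss: the missing Lean is the
   bookkeeping "entries of `medialExploration` are darts through inner faces, interior vertices are
   eventually free, `|γ| ≤ 4·#meshDomain`", plus (R1) itself).
6. WARNING (§C): replacing `F^ent` by the tree's `F^bis` in `StaggeredEntryAntiHolomorphy` gives a
   statement that is TRUE for trivial reasons (`bisector_stagger_telescope`); against the staggered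
   weight `s_z ∂φ` step 4's telescoping FAILS (`g(head) - g(tail) = ±(|g(head)| + |g(tail)|)`-size) and
   one finds instead `Σ_z s_z g D_z = 2 Σ_z s_z g t_z + O(δΣ|F|)`, i.e. the staggered entry pairing is
   HALF the staggered pairing of the Kirchhoff defect `K_z := E[D_z] = Σ_in F - Σ_out F`
   ("`F(A)+F(C) = F(B)+F(D)`", exact for FK-Ising, false for percolation — Zhou 2024 §1.3; §E gives
   `|K_z|/|t_z| ∈ [1.4 %, 5.3 %]` exactly on the `n = 3, 4` boxes).  THE CRUX IS EXACTLY: the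
   Kirchhoff defect has no `∂`-visible sublattice-staggered component at scale `δ^{1/3}`:
   `δ^{5/3} Σ_z s_z K_z ∂φ(z_δ) → 0` — the `A₂` mode of `Theorems/CoherentMorera/Negative/KirchhoffModes`.
   Exact Kirchhoff (`K ≡ 0` in the bulk) would prove the crux in one line; it is false at finite `δ`
   but numerically tiny and decaying (§E). -/

/-- The ENTRY-convention passage sum: as `MedialPath.passageSum` but with the winding on ARRIVAL
(`Polyline.winding` of the prefix ending at the passage, no half-turn), i.e. the sum over the darts
of `γ` into `z` of the dart phase of `dartPhaseSum` (plus the phase `1` of the start if `z = γ[0]`).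
[folklore] -/
def entryPassageSum (γ : List MedialVertex) (δ σ : ℝ) (z : MedialVertex) : ℂ :=
  ∑ k ∈ (Finset.range γ.length).filter (fun k => γ[k]? = some z),
    cexp (-I * σ * (Polyline.winding ((γ.map (medialPoint δ)).take (k + 1)) : ℝ))

/-- The sublattice-staggered, `δ^{5/3}`-normalised `∂`-pairing of the ENTRY-convention spin-`1/3`
vertex observable: `δ^{5/3} Σ_z s_z F^ent_δ(z) ∂φ(z_δ)`. [folklore] -/
def stagEntryPairing (Λ : ℝ → DiscreteDobrushin) (φ : ℂ → ℂ) (δ : ℝ) : ℂ :=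
  ((δ ^ ((5 : ℝ) / 3) : ℝ) : ℂ) * ∑ᶠ z : MedialVertex, stagSign z *
    (∫ ω, entryPassageSum (medialExploration (Λ δ) ω) δ (1 / 3) z
      ∂(bondPercolation (zdGraph 2) half)) * del φ (medialPoint δ z)

/-- **The crux-equivalent staggered statement** (given the exact vertex relation): the `A₂`-mode /
staggered entry `∂`-pairing vanishes in the scaling limit for every admissible family and every test
function. Conjecturally TRUE (numerics §E); open exactly as the crux is. [folklore] -/
def StaggeredEntryAntiHolomorphy : Prop :=
  ∀ (D : DobrushinDomain) (Λ : ℝ → DiscreteDobrushin), FamilyHyps D Λ →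
    ∀ φ : ℂ → ℂ, IsTestFn D φ → Tendsto (stagEntryPairing Λ φ) (𝓝[>] (0:ℝ)) (𝓝 0)

/-- The `A₂` character of a dart `c = (v, f)`: `+1` if it heads into a HORIZONTAL lattice edge (travel
classes `v - f = (1,0)` SW and `(0,1)` NE), `-1` if into a vertical one (`(0,0)` NW, `(1,1)` SE), `0` on
non-corners; i.e. `-(-1)^{a+b}` for the class `(a,b) = dartClass c`. [folklore] -/
def a2Char (c : Site 2 × Site 2) : ℂ :=
  open scoped Classical in
  if IsCorner c.1 c.2 then -((-1 : ℂ) ^ ((dartClass c 0 + dartClass c 1).natAbs)) else 0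

/-- The `A₂`-mode pairing in the DART vocabulary of `DartPhase.lean` (the one the sibling route
`CardyComplexCone` types its items in): `δ^{5/3} Σ_c a2Char(c) · bondDartObservable (Λ δ) δ (1/3) c ·
∂φ(dartMidpoint δ c)`.  Up to the start dart and the `O(δ Σ_c |F(c)|) = O(δ⁻¹)` cost of moving the
evaluation point from the dart midpoint to its head (`δ/(2√2)` away), this IS `stagEntryPairing Λ φ δ`
(every passage through `z ≠ e_a` arrives along exactly one dart into `z`, with the entry phase), so
`A2ModeVanishes ↔ StaggeredEntryAntiHolomorphy` by bookkeeping alone. [folklore] -/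
def a2Pairing (Λ : ℝ → DiscreteDobrushin) (φ : ℂ → ℂ) (δ : ℝ) : ℂ :=
  ((δ ^ ((5 : ℝ) / 3) : ℝ) : ℂ) * ∑ᶠ c : Site 2 × Site 2,
    a2Char c * bondDartObservable (Λ δ) δ (1 / 3) c * del φ (dartMidpoint δ c)

/-- **The crux in the sibling route's vocabulary**: the `A₂` Fourier mode (over the four dart classes)
of the `q = 1`, spin-`1/3` dart observable, paired with `∂φ`, vanishes at scale `δ^{-5/3}` for every
admissible family.  Given (R1) this is equivalent to `WeakHolomorphy` (§D); it is strictly weaker than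
`CardyComplexCone.EdgeCoherence`-type statements (all four classes coherent), which also kill the
`A₁, A₃` modes that weak holomorphy does not need (the sibling MC sees `A₃ ≍ δ^{1/4}·A₀ ≠ 0` at finite
`δ` but irrelevant here). [folklore] -/
def A2ModeVanishes : Prop :=
  ∀ (D : DobrushinDomain) (Λ : ℝ → DiscreteDobrushin), FamilyHyps D Λ →
    ∀ φ : ℂ → ℂ, IsTestFn D φ → Tendsto (a2Pairing Λ φ) (𝓝[>] (0:ℝ)) (𝓝 0)

/-- A medial vertex `s(x, x + eᵢ)` of the discrete Dobrushin domain `E` is FREE: it is an edge of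
`Ω_δ` whose status under `E.bcBondConfig ω` is the coin of `ω` (no endpoint on the arc `B`, not both
endpoints on the arc `A`) and whose four medial edges run through inner faces. These are exactly the
vertices at which the coin-involution proof of the vertex relation applies. [folklore] -/
def IsFreeMedialVertex (E : DiscreteDobrushin) (x : Site 2) (i : Fin 2) : Prop :=
  s(x, x + Pi.single i 1) ∈ (discreteDomainGraph E.Ω E.δ).edgeSet ∧
    x ∉ E.zdArcB ∧ x + Pi.single i 1 ∉ E.zdArcB ∧ ¬ (x ∈ E.zdArcA ∧ x + Pi.single i 1 ∈ E.zdArcA) ∧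
    ∀ k : Fin 4, E.IsInnerFace (Literature.Barriers.CriticalPhenomena.medialCornersAt x i k).2

/-- (R1) **The exact vertex relation in the tree's conventions** (Duminil-Copin 2012 Prop. 4 /
DCS 2012 Prop. 8.6 at `q = 1`, `σ = 1/3`, chirality `+i` in the clockwise compass labels of
`HalfCRRelationAt`): for admissible data and every free medial vertex,
`F(NW) - F(SE) = i (F(NE) - F(SW))` for the dart observable `bondDartObservable E E.δ (1/3)`.
Verified exactly on all boxes `n ≤ 4` (§E) and by the sibling disprovers; its proof is the coin
involution at the vertex. Stated here as the HYPOTHESIS of the reduction, not claimed.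
[cite: DuminilCopin2012Parafermion, Proposition 4] -/
def VertexRelationExact : Prop :=
  ∀ (E : DiscreteDobrushin), E.IsZdAdmissible → ∀ (x : Site 2) (i : Fin 2), IsFreeMedialVertex E x i →
    Literature.Barriers.CriticalPhenomena.HalfCRRelationAt I (bondDartObservable E E.δ (1 / 3)) (x, i)

/-- **Near-miss (typed reduction target).** Given the exact vertex relation (R1), the crux is
EQUIVALENT to the vanishing of the staggered entry pairing (the `A₂` mode), by steps 2–5 of the §D
docstring; the two normalised pairings differ by `-(i/cos(π/12))·` each other plus `O(δ^{2/3})`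
deterministically.  Sorried: the remaining Lean is bookkeeping on `medialExploration` (entries are
darts through inner faces; interior vertices eventually free; `E|γ| ≤ #darts = O(δ⁻²)`; first-order
Taylor of `φ ∈ C_c^∞`), none of it probabilistic.  Obstruction to closing it HERE: some hundred lines
of corner geometry on top of `MedialInterfaceProofs`; what was tried: the algebraic cores (§C,
`bisector_stagger_telescope`; the scalar identities `stagger_key_pos/neg`). [folklore] -/
theorem weakHolomorphy_iff_staggeredEntry_of_vertexRelation (hV : VertexRelationExact) :
    WeakHolomorphy ↔ StaggeredEntryAntiHolomorphy := by
  sorry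

/-! ## §E Exact small-box tables and Monte-Carlo (this unit)

Set-up (= the tree's conventions, re-implemented twice: `mc/twin_pure.py` in pure Python, run on the
hub, and `mc/weakholo_mc.py`, numpy, kit jobs): bond percolation `p = 1/2` on the box `{0..n}²`,
H21 rendering `bcBondConfig` with arc `A` = bottom + right sides (wired), arc `B` = left + top
(edges touching it closed), `e_a = H(n-1, n)` (first corner `((n,n), SE)`), `e_b = V(0,0)`; medial
exploration by the turning rule of `IsMedialTurn` (target edge open ⇒ turn right inside the face,
closed ⇒ turn left around the vertex; open cluster of `A` on the LEFT); winding ccw-positive from the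
initial direction; dart phase `exp(-iσW_e)`, `W_e` = winding on arrival at the target.
Checked pathwise for every configuration: termination at `e_b`, no dart reused, all faces inner.

EXACT ENUMERATION (all `2^{2(n-1)²}` coin configurations; `F(e)` = dart observable):
* `n = 2, 3, 4`, `σ = 1/3`: vertex relation (R1) `Σ_out û F = Σ_in û F` holds at EVERY free vertex to
  `5·10⁻¹⁷ / 2·10⁻¹⁵ / 4·10⁻¹³` (accumulated rounding); the mirrored combination (conj `û`) is
  `0.96–1.50`; `max |F(e)| = 1`.  ⇒ chirality `χ = +i` = `HalfCRRelationAt I` in the tree's frame.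
* spin is load-bearing for (R1): `max_z |R1 defect| = 0.50 (σ=0), 0.061 (σ=1/2), 0.051 (σ=2/3),
  1.50 (σ=-1/3)`, and `2·10⁻¹⁶` at `σ = 1` (degenerate: `(−i)^W`-weighted Kirchhoff).
* Kirchhoff defect `K_z = Σ_in F - Σ_out F` (`σ = 1/3`): NON-ZERO but small — `n = 3`:
  `|K_z|/|t_z| = 1.4 %, 5.3 %, 5.3 %, 3.9 %` (h-vertices (1,1),(1,2),(2,1),(2,2)), the v-vertices carry
  the mirror values with OPPOSITE sign (`K_{(2,1),v} = -K_{(1,1),h} = +0.0122+0.0071i`), i.e. the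
  field `s_z K_z` is smooth, not oscillating; `n = 4`: `max |K|/|t| ≈ 5 %`, `max|K| = 0.0505`.
  `K ≡ 0` exactly at `σ = 0` (trivial) and at `σ = 2/3` (the dual spin `1 - σ`; there (R1) fails).
  So "exact Kirchhoff ⇒ crux in one line" is NOT available; the crux needs `s_z K_z = o(δ^{1/3})`
  weakly, and the sibling crux's Monte-Carlo (5×5 central block averages, `L = 16…256`) already has
  the corresponding `A₂` mode at `≤ 2·10⁻³` of `A₀`, below its noise.  NB the smooth (non-staggered)
  part of `K` is negligible AUTOMATICALLY (`Σ_z w(z)K_z = Σ_e F(e)(w(head e) - w(tail e)) = O(δΣ|F|)`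
  for smooth `w`, §D step 4), so at finite `δ` the defect is predominantly STAGGERED — as the tables show.
* A SECOND exact local relation (visit multiplicity; `mc/twin_zhou102.py`, `n = 3, 4`, defect
  `≤ 3·10⁻¹³`): with `K^{(m)}_z := E[(Σ_in P - Σ_out P)·1{z visited m times}]` (`m = 1, 2`),
  `√3·K^{(1)}_z + K^{(2)}_z = 0` at every free vertex, i.e. `K_z = (1 - √3) K^{(1)}_z`.  Proof (coin
  involution again, cdisprove derivation): fix the configuration off the coin of `z`; if the `b`-strand
  leaves by the right-turn exit, then open ⇒ one visit with `in - out = P(1 - e^{iπ/6})`, closed ⇒ two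
  visits with `in - out = P(1 + e^{iπ/3} - e^{-iπ/6} - e^{iπ/6}) = -√3·P(1 - e^{iπ/6})`; the other
  topology is the complex-conjugate case.  This is eq. (102) of Zhou 2024 (his `F_one/F_two` are the
  once/twice splits up to his exceptional events) and the expectation form of TRIAGE-r1-1 V3+V4
  (`D = 2i sin(π/12) ε T^bis`, `T^bis(ω^z) = √3^{±1} T^bis(ω)`); like (R1) it is a same-vertex coin
  identity (barrier class), it refines the unknowns rather than closing them.  Observed `t^{(2)}/t^{(1)}
  ≈ 1.5–2.0` (twice-visit vs once-visit entry totals).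
MONTE-CARLO (kit jobs of this unit, results auto-attach to the item as `compute-j00814{3,7,8,9}.json`;
folded into this block when delivered): direct measurement of the crux quantity
`T_∂̄(L) = L^{-5/3} E Σ_k P^bis_k ∂̄Φ(m_k/L)` versus the reference `T_∂(L)` (same with `∂Φ`), the
staggered entry pairing `T_stag` (prediction of §D: `T_∂̄ ≈ -(i/cos(π/12)) T_stag`), and the
convention check `E1 = L^{-5/3}E Σ_e P_e(û_e²∂Φ + ∂̄Φ)(m_e) ≈ 0` (‡), for three bumps `Φ` on the unit
square, `L = 16, 32` (10⁶ samples each, j008143, with the exact `n = 3, 4` tables recomputed in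
numpy), `64` (5·10⁵, j008147), `128` (2·10⁵, j008148), `256` (5·10⁴, j008149).  Reading guide: crux
plausible ⇔ `|T_∂̄|/|T_∂|` decreasing in `L`; a constant ratio at the `10⁻³` level down to `L = 256`
would be the first numerical tension with the crux ever recorded (none expected). -/

/-! ## §F Load-bearing table (heuristic unless marked THEOREM) and junk audit

* `tsupport φ ⊆ D.carrier` — LOAD-BEARING: with `φ` non-zero up to `∂D` the discrete Green formula
  produces the boundary term `∮ f φ dz ≠ 0` (boundary values of `F_δ` are `P(z ∈ γ)·`(deterministic
  phase) `≍ δ^{1/3}` per boundary vertex).  Not Lean-refutable (needs the scaling limit).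
* `HasCompactSupport φ` — REDUNDANT (THEOREM `hasCompactSupport_of_tsupport_subset`).
* `ContDiff ℝ ⊤ φ` — only `C¹` is typed (through `fderiv`); the reduction of §D uses `C³` (Taylor
  remainder in (‡)); `C^∞` is harmless slack.
* exponent `5/3` — THEOREM `weakHolomorphyParam_mono`: an up-set in the exponent; `5/3 = 2 - σ` is the
  DCS normalisation (medial density `2/δ²`, `F_δ ≍ δ^{1/3}`); smaller exponents additionally assert a
  RATE for the `∂̄`-defect, larger ones are weaker.  A kill at exponent `5/3` kills every `s ≤ 5/3`.
* spin `1/3` — load-bearing for every known mechanism ((R1) holds only at `σ = 1/3`, §E); at `σ = 0`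
  the statement says the two-arm density is weakly holomorphic at scale `δ^{1/3}` — false under the
  conjectured `δ^{1/4}` two-arm scaling, unprovable on `ℤ²` either way.
* `(Λ δ).IsZdAdmissible` eventually — load-bearing for MEANING, not for truth: without it
  `medialExploration` may be the junk `[]` (`F_δ ≡ 0`, conclusion true) or a genuine exploration of
  non-Dobrushin data (e.g. four arcs), whose bulk observable is again conjecturally holomorphic.
* `(Λ δ).Ω = D.carrier`, h3–h5 (Hausdorff convergence of arcs / marks) — "possibly unnecessary":
  h3 + h4 + h6 already force the discrete boundary of `(Λ δ).Ω` into an `o(1)`-neighbourhood of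
  `∂D` (every site of `zdBoundary` must be closer to `arcA(δ) ∪ arcB(δ)` than `O(δ)`), and the claim is
  interior.  THEOREM `weakHolomorphy_of_threeHyp`: the 3-hypothesis form implies the crux.
* JUNK AUDIT (all clean, confirming the three one-shot seats): `DobrushinDomain = MarkedDomain 2` is a
  genuine Jordan domain (carrier = interior of the boundary curve by `range_boundary = frontier` +
  connectedness); admissible `Λ` has its discrete arcs pinned within `o(1)` of `D.arc 0 / D.arc 1`
  except near the marks; `medialExploration` is the cut orbit (`existsUnique_medialExploration_holds`);
  the integrand is bounded (≤ 2 passages) and cylinder-measurable on the finite edge set of `Ω_δ`; the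
  `finsum` is finitely supported (`passageSum` vanishes off the path, a subset of the darts of the
  finite `Ω_δ`; `∂̄φ` vanishes off `tsupport φ`); `Real.rpow` at `δ > 0`; `(∂ₓ + i∂_y)/2 = ∂̄`;
  chirality correct (§E and the DC2012 Prop. 4 table).  Non-vacuity: `UnitDiscDiscretisation.discData`
  satisfies all six hypotheses (certified by the one-shot seats, `Scratch4.lean` on the item).
* BARRIERS: `FKParafermionicHalfCauchyRiemann(_holds/Narrow)` obstruct same-size exact DETERMINATION
  of `F` from (R1); the crux is their listed evasion (b) (asymptotic second relation, weak form) — not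
  bitten; §D shows precisely which asymptotic second relation: the staggered `A₂`/Kirchhoff-defect mode.
* NEGATIVES INDEX (`ledger negatives`): nothing on FK parafermions; the `Sym2`-diagonal window junk
  that killed `CardyDualCurrent.DualCurrentTemplate` (6949) is absent here (`passageSum` vanishes on
  non-edges, and the pairing weight is smooth, not a window indicator).
* TARGETS (lead's stuck stubs): none yet (payload `stuck_stubs = []`). -/

/-! ## §G The only claimed proof in print (Zhou, arXiv:2409.03235v6, unrefereed) mapped onto the crux

Read this unit (`lit read arxiv:2409.03235`, pp. 1–9, 21–25, 51–55).  (i) Strategy (p. 7): Smirnov's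
edge observable `F` obeys (R1) but NOT Kirchhoff `F(A)+F(C) = F(B)+F(D)`; Zhou splits `F = F̃ + F_i`
with (Prop. 4.3, p. 55) `F̃` obeying (R1) EXACTLY (95) and Kirchhoff up to `O((δ/d_v)²)` (96), `F_i`
obeying (R1) (97) and ANTI-Kirchhoff `F_i(A)+F_i(C) = -(F_i(B)+F_i(D)) + O((δ/d_v)²)` (98); then
discrete `∫δ⁻¹F̃³dz`, harmonic analysis, `δ^{-1/3}F̃ →` holomorphic and `δ^{-1/3}F_i → 0` (§5.7–5.8).
(ii) Dictionary: the Kirchhoff defect of the true observable is `K = K[F̃] + K[F_i] = O(δ²/d²) + 2Σ_in F_i`,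
so "`δ^{-1/3}F_i → 0` locally uniformly" is the POINTWISE strengthening of this crux's `A₂`-statement
(§D step 6: crux ⇔ staggered part of `K` is `o(δ^{1/3})` weakly; the smooth part is automatic).
WHERE `F_i → 0` IS ARGUED (Prop. 5.18, pp. 95–96, read this unit): sublattice-wise precompactness of
`δ^{-1/3}F_i` on `V_h` and on `V_v` (Lemma 5.16 + (181), resting on the Section-2/3 surgeries via the
"translation property" (94)), limits `F_iH = -F_iV` (so HIS `F_i` IS ASYMPTOTICALLY A PURE STAGGERED
FIELD — exactly the `A₂`/staggered-`K` mode of §D, independent confirmation of the reduction), cubic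
line-integral identities (185) `Im(F_iH³) = Im(c_iΦ′)`, `Re(F_iV³) = Re(c_iΦ′)` with the REAL constant
`c_i = lim Im ∫_C δ⁻¹F_i³dz` of (162), universality of `c, c_i` over domains ("from the proof of
(206)"), and finally `c_i = 0` from the reflection symmetry (186) of the unit square with `a, b` on a
diagonal: (188) "LHS imaginary, RHS real ⇒ c_i = 0".  Two points a reading/replication unit must
settle (provisional: the text extraction loses overlines): (α) (185) with `F_iH = -F_iV` gives
`F_iH³ = -Re(c_iΦ′) + i·Im(c_iΦ′) = -c_i·conj(Φ′)`, an ANTI-holomorphic cube, while (187) asserts the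
holomorphic `F_iH = -c_i^{1/3}(Φ′)^{1/3}` — as printed these are inconsistent unless `Im(c_iΦ′) ≡ 0`;
(β) from (188) one only gets `Re((c_iΦ′e_b)^{1/3}) = 0` along the diagonal, where `Φ′e_b > 0`; with
`c_i` real this kills `c_i` only for the real branch of the cube root, and the branch is whatever the
subsequential limit `F_iH` is — the page gives no argument fixing it.  So the crux-relevant step of the
only claimed proof is, at best, incompletely written; at worst (α) is a genuine gap.
(iii) Inputs that are NOT theorems: the half-plane one-arm bound (10) p. 7, `c₀⁻¹R^{-1/3} ≤ P(A₁⁺(0,R))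
≤ c₀R^{-1/3}` on bond-`ℤ²`, is credited (p. 8) to "[IkPon12]" (Ikhlef–Ponsaing 2012, a Coulomb-gas /
numerical transfer-matrix physics paper) — the exponent `1/3` is rigorous only on the triangular
lattice; and the whole of Section 3 (pp. 22–50: configuration surgery "rotation around a medial vertex",
reflected loops `L_v^{AC}`, three subcases × two cases, bijectivity "after neglecting an event of
probability `(δ/d)²`") defines the classes `E^v_{j,m}` entering `F_{π/12}` and hence `F̃` (81) — not
checkable by a small exact computation without re-implementing the surgery (the definition of `F̃` is
not a closed-form local functional of `γ`).  What IS checkable was checked here: his (2) = (R1) ✓ and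
his (102) = `√3K^{(1)} + K^{(2)} = 0` ✓ exactly (§E).
(iv) Consequence for this crux: no refutation and no certified proof; the preprint's decomposition is
the most concrete candidate mechanism on record for the `A₂`-mode statement and deserves a dedicated
reading/replication unit (grounder note of 2026-08-15 concurs).  Heuristic support independent of it:
the staggered Kirchhoff mode flips sign under the lattice quarter-turn (`s_{Rz} = -s_z`, `K` intrinsic),
so its continuum amplitude is a spin-`±2 (mod 4)` field; at `c = 0` the natural carrier is the
stress-tensor channel of dimension `2`, predicting `K^{stag} ∼ (δ/d)^{2}·δ^{1/3}`-type decay relative —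
consistent with Zhou's `O(δ²)` bookkeeping, with the `1–6 %` defects at `d ≈ 1–2` lattice units (§E)
and with the sibling MC's `A₂` at noise for `d ≥ 8`; this unit's MC (j008143…) measures the decay. -/

end Summit.CriticalPhenomena.CardyFormulaZ2.Cruxes.WeakHolomorphy.Disproof
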